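import Summits.CriticalPhenomena.CardyFormulaZ2.Theorems.CardyUSTContinuationKirchhoffExtremalLengthG02MissingEdge
import Summits.CriticalPhenomena.CardyFormulaZ2.Theorems.CardyUSTContinuationKirchhoffExtremalLengthDefs
import Literature.Probability.LatticeModels.SquareTilingConjugate

/-!
# Inner faces of `Ω_δ` and walks of inner faces: no winding around discrete boundary vertices
# ([GP19] §3.1 for the `meshDomain` / `discreteArc` discretisation)

Support file for `KirchhoffExtremalLength` (route CardyUSTContinuation of `CardyFormulaZ2`, item
stmt-CriticalPhenomena-11234), towards the upper half of `G02ModulusConvergence` (`…Defs.lean`)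
by the discrete harmonic conjugate. Transposition of §D1/§D3 of the tree's
`SquareTilingConjugate.lean` from the Georgakopoulos–Panagiotis graph to
`Ω_δ = discreteDomainGraph Ω δ` (inner faces `IsInnerFace`, face graph `faceGraph` of
`…Defs.lean`):

* bookkeeping of inner faces and the face graph (`faceGraph_adj_iff`, `isInnerFace_of_mem_support`,
  `not_isInnerFace_inf`);
* **inner faces lie in `Ω̄`, their open squares in `Ω`** (`closedSq_subset_closure_of_isInnerFace`,
  Jordan curve theorem), so a face containing an exterior point is not inner, and inner faces
  have their index in a bounded box (`mem_sqBox_of_isInnerFace`);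
* **walks of inner faces do not wind around vertices of `∂Ω_δ`**
  (`walkWinding_eq_zero_of_mem_meshBoundary`): the missing edge at a discrete boundary vertex
  meets `∂Ω` (`exists_mem_frontier_of_not_discreteDomainGraph_adj`), near which an exterior path,
  shadowed by a king chain of non-inner faces, leaves the bounding box of the walk.
-/

noncomputable section

namespace Summit.CriticalPhenomena.CardyFormulaZ2.Theorems

namespace KirchhoffSlope

open Set Metric Filter Topology SimpleGraph
open Literature.Probability Literature.Probability.LatticeModels Literature.Probability.Percolation
open Literature.Probability.LatticeModels.SquareTiling (corners mem_corners_iff sup_mem_corners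
  walkWinding_eq_of_cornerChain closedSq floorSq mem_closedSq_floorSq abs_sub_floorSq_le_of_mem_closedSq
  exists_kingChain_of_path segment_subset_closedSq_inf mem_corners_inf mem_segment_horizontal
  mem_segment_vertical)
open Literature.Probability.RandomPlanarGeometry

variable {Ω : Set ℂ} {δ : ℝ}

/-! ### Inner faces and the face graph -/

/-- The face graph is a subgraph of the lattice `ℤ²` (implicit-argument form of
`faceGraph_le_zdGraph`). [folklore] -/
theorem faceGraph_le_zdGraph' : faceGraph Ω δ ≤ zdGraph 2 := faceGraph_le_zdGraph Ω δ

/-- Adjacency in the face graph. [folklore] -/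
theorem faceGraph_adj_iff {p p' : Site 2} :
    (faceGraph Ω δ).Adj p p' ↔ (zdGraph 2).Adj p p' ∧ IsInnerFace Ω δ p ∧ IsInnerFace Ω δ p' := by
  simp only [faceGraph, SimpleGraph.fromRel_adj, ne_eq]
  constructor
  · rintro ⟨-, ⟨h, h1, h2⟩ | ⟨h, h1, h2⟩⟩
    · exact ⟨h, h1, h2⟩
    · exact ⟨h.symm, h2, h1⟩
  · rintro ⟨h, h1, h2⟩
    exact ⟨h.ne, Or.inl ⟨h, h1, h2⟩⟩

/-- Vertices on a non-trivial walk of the face graph are inner faces. [folklore] -/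
theorem isInnerFace_of_mem_support {a b : Site 2} (Λ : (faceGraph Ω δ).Walk a b) (hab : a ≠ b ∨ 0 < Λ.length)
    {q : Site 2} (hq : q ∈ Λ.support) : IsInnerFace Ω δ q := by
  induction Λ with
  | nil => rcases hab with h | h <;> simp at h
  | cons h p ih =>
    rename_i x y z
    rw [Walk.support_cons, List.mem_cons] at hq
    rcases hq with rfl | hq
    · exact (faceGraph_adj_iff.1 h).2.1
    · cases p with
      | nil => simp only [Walk.support_nil, List.mem_singleton] at hq; subst hq
               exact (faceGraph_adj_iff.1 h).2.2
      | cons h' p' => exact ih (Or.inr (by simp)) hq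

/-- All squares of a closed face-graph walk based at an inner face are inner faces. [folklore] -/
theorem isInnerFace_of_mem_support_map {a : Site 2} (ha : IsInnerFace Ω δ a)
    (Λ : (faceGraph Ω δ).Walk a a) {q : Site 2}
    (hq : q ∈ (Λ.map (Hom.ofLE (faceGraph_le_zdGraph Ω δ))).support) : IsInnerFace Ω δ q := by
  rw [Walk.support_map, List.mem_map] at hq
  obtain ⟨q', hq', rfl⟩ := hq
  by_cases hlen : Λ.length = 0
  · have hs : Λ.support = [a] := Walk.nil_iff_support_eq.mp (Walk.length_eq_zero_iff.mp hlen)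
    rw [hs, List.mem_singleton] at hq'
    subst hq'
    exact ha
  · exact isInnerFace_of_mem_support Λ (Or.inr (Nat.pos_of_ne_zero hlen)) hq'

/-- The two squares having the horizontal lattice edge `{x, x + e₀}` as a side are `x - e₁`
(below) and `x` (above); if that edge is not an edge of `Ω_δ`, neither is an inner face. [folklore] -/
theorem not_isInnerFace_of_not_adj_right {x : Site 2} (h : ¬ (discreteDomainGraph Ω δ).Adj x (x + Pi.single 0 1)) :
    ¬ IsInnerFace Ω δ x ∧ ¬ IsInnerFace Ω δ (x - Pi.single 1 1) := by
  refine ⟨fun hI => h hI.1, fun hI => h ?_⟩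
  have := hI.2.1
  simpa using this

/-- Vertical version: the squares `x - e₀` (left) and `x` (right) of the edge `{x, x + e₁}`. [folklore] -/
theorem not_isInnerFace_of_not_adj_up {x : Site 2} (h : ¬ (discreteDomainGraph Ω δ).Adj x (x + Pi.single 1 1)) :
    ¬ IsInnerFace Ω δ x ∧ ¬ IsInnerFace Ω δ (x - Pi.single 0 1) := by
  refine ⟨fun hI => h hI.2.2.1, fun hI => h ?_⟩
  have := hI.2.2.2
  simpa using this

/-- If the lattice edge `{x, y}` is not an edge of `Ω_δ`, the square `x ⊓ y` (of which it is a
side) is not an inner face. [folklore] -/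
theorem not_isInnerFace_inf {x y : Site 2} (hxy : (zdGraph 2).Adj x y)
    (h : ¬ (discreteDomainGraph Ω δ).Adj x y) : ¬ IsInnerFace Ω δ (x ⊓ y) := by
  rcases stepKind_of_adj hxy with ⟨h0, h1⟩ | ⟨h0, h1⟩ | ⟨h1, h0⟩ | ⟨h1, h0⟩
  · have hq : x ⊓ y = x := by ext i; fin_cases i <;> simp <;> omega
    have hy : y = x + Pi.single 0 1 := by simp [Site.eq_iff_two, h0, h1]
    rw [hq]; rw [hy] at h
    exact (not_isInnerFace_of_not_adj_right h).1
  · have hq : x ⊓ y = y := by ext i; fin_cases i <;> simp <;> omega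
    have hx : x = y + Pi.single 0 1 := by simp [Site.eq_iff_two, h0, h1]
    rw [hq]; rw [hx] at h
    exact (not_isInnerFace_of_not_adj_right fun h' => h h'.symm).1
  · have hq : x ⊓ y = x := by ext i; fin_cases i <;> simp <;> omega
    have hy : y = x + Pi.single 1 1 := by simp [Site.eq_iff_two, h0, h1]
    rw [hq]; rw [hy] at h
    exact (not_isInnerFace_of_not_adj_up h).1
  · have hq : x ⊓ y = y := by ext i; fin_cases i <;> simp <;> omega
    have hx : x = y + Pi.single 1 1 := by simp [Site.eq_iff_two, h0, h1]
    rw [hq]; rw [hx] at h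
    exact (not_isInnerFace_of_not_adj_up fun h' => h h'.symm).1

/-- The corners of an inner face are vertices of `Ω_δ`; in particular their mesh points lie in
`Ω`. [folklore] -/
theorem meshPoint_mem_of_isInnerFace {q : Site 2} (hq : IsInnerFace Ω δ q) : meshPoint δ q ∈ Ω :=
  meshDomain_subset_meshVertices _ _ (discreteDomainGraph_adj_iff.1 hq.1).2.1

/-! ### Inner faces lie in the closure of the domain -/

/-- **Inner faces lie in `Ω̄`** (the four sides are closed segments in `Ω̄`, and the open square
lies in `Ω` by the Jordan curve theorem, `JordanDomain.openRect_subset_of_sides_subset_closure`).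
[folklore] -/
theorem closedSq_subset_closure_of_isInnerFace (R : ConformalRectangle) (hδ : 0 < δ)
    {q : Site 2} (hq : IsInnerFace R.carrier δ q) : closedSq δ q ⊆ closure R.carrier := by
  obtain ⟨hB, hT, hL, hR⟩ := hq
  have segB := (meshGraph_adj_iff.1 (discreteDomainGraph_adj_iff.1 hB).1).2
  have segT := (meshGraph_adj_iff.1 (discreteDomainGraph_adj_iff.1 hT).1).2
  have segL := (meshGraph_adj_iff.1 (discreteDomainGraph_adj_iff.1 hL).1).2
  have segR := (meshGraph_adj_iff.1 (discreteDomainGraph_adj_iff.1 hR).1).2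
  -- the four sides
  have hbot : ∀ X : ℝ, δ * q 0 ≤ X → X ≤ δ * (q 0 + 1) → (⟨X, δ * q 1⟩ : ℂ) ∈ closure R.carrier := by
    intro X h0 h1
    refine segB ?_
    have e1 : meshPoint δ q = ⟨δ * q 0, δ * q 1⟩ := Complex.ext (by simp) (by simp)
    have e2 : meshPoint δ (q + Pi.single 0 1) = ⟨δ * (q 0 + 1), δ * q 1⟩ :=
      Complex.ext (by simp) (by simp)
    rw [e1, e2]
    exact mem_segment_horizontal h0 h1 (by nlinarith)
  have htop : ∀ X : ℝ, δ * q 0 ≤ X → X ≤ δ * (q 0 + 1) → (⟨X, δ * (q 1 + 1)⟩ : ℂ) ∈ closure R.carrier := by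
    intro X h0 h1
    refine segT ?_
    have e1 : meshPoint δ (q + Pi.single 1 1) = ⟨δ * q 0, δ * (q 1 + 1)⟩ :=
      Complex.ext (by simp) (by simp)
    have e2 : meshPoint δ (q + Pi.single 1 1 + Pi.single 0 1) = ⟨δ * (q 0 + 1), δ * (q 1 + 1)⟩ :=
      Complex.ext (by simp) (by simp)
    rw [e1, e2]
    exact mem_segment_horizontal h0 h1 (by nlinarith)
  have hleft : ∀ Y : ℝ, δ * q 1 ≤ Y → Y ≤ δ * (q 1 + 1) → (⟨δ * q 0, Y⟩ : ℂ) ∈ closure R.carrier := by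
    intro Y h0 h1
    refine segL ?_
    have e1 : meshPoint δ q = ⟨δ * q 0, δ * q 1⟩ := Complex.ext (by simp) (by simp)
    have e2 : meshPoint δ (q + Pi.single 1 1) = ⟨δ * q 0, δ * (q 1 + 1)⟩ :=
      Complex.ext (by simp) (by simp)
    rw [e1, e2]
    exact mem_segment_vertical h0 h1 (by nlinarith)
  have hright : ∀ Y : ℝ, δ * q 1 ≤ Y → Y ≤ δ * (q 1 + 1) → (⟨δ * (q 0 + 1), Y⟩ : ℂ) ∈ closure R.carrier := by
    intro Y h0 h1
    refine segR ?_
    have e1 : meshPoint δ (q + Pi.single 0 1) = ⟨δ * (q 0 + 1), δ * q 1⟩ :=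
      Complex.ext (by simp) (by simp)
    have e2 : meshPoint δ (q + Pi.single 0 1 + Pi.single 1 1) = ⟨δ * (q 0 + 1), δ * (q 1 + 1)⟩ :=
      Complex.ext (by simp) (by simp)
    rw [e1, e2]
    exact mem_segment_vertical h0 h1 (by nlinarith)
  -- the open square, by the Jordan curve theorem
  have hopen : (Ioo (δ * q 0) (δ * (q 0 + 1)) ×ℂ Ioo (δ * q 1) (δ * (q 1 + 1))) ⊆ R.carrier := by
    refine R.openRect_subset_of_sides_subset_closure (fun z hz h0 h1 => ?_) (fun z hz h0 h1 => ?_)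
    · rcases hz with hz | hz
      · have : z = ⟨δ * q 0, z.im⟩ := Complex.ext hz rfl
        rw [this]; exact hleft _ h0 h1
      · have : z = ⟨δ * (q 0 + 1), z.im⟩ := Complex.ext hz rfl
        rw [this]; exact hright _ h0 h1
    · rcases hz with hz | hz
      · have : z = ⟨z.re, δ * q 1⟩ := Complex.ext rfl hz
        rw [this]; exact hbot _ h0 h1
      · have : z = ⟨z.re, δ * (q 1 + 1)⟩ := Complex.ext rfl hz
        rw [this]; exact htop _ h0 h1
  intro z hz
  obtain ⟨h0, h0', h1, h1'⟩ := hz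
  rcases h0.eq_or_lt with e | l0
  · have : z = ⟨δ * q 0, z.im⟩ := Complex.ext e.symm rfl
    rw [this]; exact hleft _ h1 h1'
  rcases h0'.eq_or_lt with e | l0'
  · have : z = ⟨δ * (q 0 + 1), z.im⟩ := Complex.ext e rfl
    rw [this]; exact hright _ h1 h1'
  rcases h1.eq_or_lt with e | l1
  · have : z = ⟨z.re, δ * q 1⟩ := Complex.ext rfl e.symm
    rw [this]; exact hbot _ h0 h0'
  rcases h1'.eq_or_lt with e | l1'
  · have : z = ⟨z.re, δ * (q 1 + 1)⟩ := Complex.ext rfl e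
    rw [this]; exact htop _ h0 h0'
  exact subset_closure (hopen ⟨⟨l0, l0'⟩, ⟨l1, l1'⟩⟩)

/-- A face containing an exterior point (a point outside `Ω̄`) is not an inner face. [folklore] -/
theorem not_isInnerFace_of_mem_closedSq (R : ConformalRectangle) (hδ : 0 < δ)
    {q : Site 2} {z : ℂ} (hz : z ∈ closedSq δ q) (hzΩ : z ∉ closure R.carrier) : ¬ IsInnerFace R.carrier δ q :=
  fun hq => hzΩ (closedSq_subset_closure_of_isInnerFace R hδ hq hz)

/-- Vertices of `Ω_δ` have their index in the box of size `⌈r₀/δ⌉` when `Ω ⊆ B̄(0, r₀)`. [folklore] -/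
theorem mem_sqBox_of_mem_meshDomain {r₀ : ℝ} (hΩ : Ω ⊆ closedBall 0 r₀) (hδ : 0 < δ) {x : Site 2}
    (hx : x ∈ meshDomain Ω δ) : x ∈ WeakBeurling.sqBox 0 ⌈r₀ / δ⌉ := by
  have hxΩ : meshPoint δ x ∈ Ω := meshDomain_subset_meshVertices _ _ hx
  have hn : ‖meshPoint δ x‖ ≤ r₀ := by simpa using hΩ hxΩ
  have hc : r₀ / δ ≤ ⌈r₀ / δ⌉ := Int.le_ceil _
  rw [div_le_iff₀ hδ] at hc
  have key : ∀ i : Fin 2, |(x i : ℝ)| * δ ≤ r₀ := by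
    intro i
    have h1 : |δ * (x i : ℝ)| ≤ ‖meshPoint δ x‖ := by
      fin_cases i
      · simpa using Complex.abs_re_le_norm (meshPoint δ x)
      · simpa using Complex.abs_im_le_norm (meshPoint δ x)
    rw [abs_mul, abs_of_pos hδ] at h1
    linarith
  rw [WeakBeurling.mem_sqBox]
  constructor <;> [have := key 0; have := key 1] <;>
  · simp only [Pi.zero_apply, sub_zero]
    have : (|x _| : ℝ) ≤ ⌈r₀ / δ⌉ := le_of_mul_le_mul_right (by nlinarith) hδ
    exact_mod_cast this

/-- Inner faces have their index in the box of size `⌈r₀/δ⌉` when `Ω ⊆ B̄(0, r₀)`. [folklore] -/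
theorem mem_sqBox_of_isInnerFace {r₀ : ℝ} (hΩ : Ω ⊆ closedBall 0 r₀) (hδ : 0 < δ) {q : Site 2}
    (hq : IsInnerFace Ω δ q) : q ∈ WeakBeurling.sqBox 0 ⌈r₀ / δ⌉ :=
  mem_sqBox_of_mem_meshDomain hΩ hδ (discreteDomainGraph_adj_iff.1 hq.1).2.1

/-! ### Walks of inner faces do not wind around discrete boundary vertices -/

open WeakBeurling in
/-- **Walks of inner faces do not wind around vertices of `∂Ω_δ`.** For a conformal rectangle, a
closed walk in the face graph of `Ω_δ` based at an inner face, and a vertex `x ∈ meshBoundary`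
(some lattice edge at `x` is not an edge of `Ω_δ`): the winding number about `x` vanishes.
Route (as in the tree's `SquareTiling.walkWinding_eq_zero_of_mem_boundary`): the missing edge
at `x` meets `∂Ω` at a point `j`; `x` is a corner of the non-inner square on that edge, which
shares a corner with the square of an exterior point near `j`, from which a path in the
(connected, unbounded) exterior, shadowed by a king chain of non-inner squares, leads outside the
bounding box of the walk. [folklore] -/
theorem walkWinding_eq_zero_of_mem_meshBoundary (R : ConformalRectangle)
    (hδ : 0 < δ) {a : Site 2} (ha : IsInnerFace R.carrier δ a)
    (Λ : (faceGraph R.carrier δ).Walk a a) {x : Site 2} (hx : x ∈ meshBoundary R.carrier δ) :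
    walkWinding (Λ.map (Hom.ofLE (faceGraph_le_zdGraph R.carrier δ))) (x - 1) = 0 := by
  -- the support consists of inner faces
  have hsupp : ∀ q ∈ (Λ.map (Hom.ofLE (faceGraph_le_zdGraph R.carrier δ))).support,
      IsInnerFace R.carrier δ q := fun q hq => isInnerFace_of_mem_support_map ha Λ hq
  -- the missing edge at `x`, the frontier point `j` on it and the non-inner square `Q₁ = x ⊓ y`
  obtain ⟨hxD, y, hxy, hnadj⟩ := hx
  obtain ⟨j, hjseg, hjf⟩ := exists_mem_frontier_of_not_discreteDomainGraph_adj R.toJordanDomain hxD hxy hnadj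
  have hQ₁ : ¬ IsInnerFace R.carrier δ (x ⊓ y) := not_isInnerFace_inf hxy hnadj
  have hjQ₁ : j ∈ closedSq δ (x ⊓ y) := segment_subset_closedSq_inf hδ.le hxy hjseg
  -- an exterior point near `j` and its square `Q'`
  obtain ⟨e', he', hje'⟩ := Metric.mem_closure_iff.1 (R.frontier_subset_closure_exterior' hjf) (δ / 2)
    (by positivity)
  have hQ' : ∃ c, c ∈ corners (x ⊓ y) ∧ c ∈ corners (floorSq δ e') :=
    ⟨_, sup_mem_corners (abs_sub_floorSq_le_of_mem_closedSq hδ hjQ₁ hje' 0)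
      (abs_sub_floorSq_le_of_mem_closedSq hδ hjQ₁ hje' 1)⟩
  -- a far exterior point and an exterior path to it
  obtain ⟨r₀, hr₀⟩ := (isBounded_iff_subset_closedBall (0 : ℂ)).1 R.isBounded
  have hr₀nn : 0 ≤ r₀ := (norm_nonneg _).trans (by simpa using hr₀ (meshPoint_mem_of_isInnerFace ha))
  set N : ℤ := ⌈r₀ / δ⌉ with hN
  have hNnn : 0 ≤ (N : ℝ) := (div_nonneg hr₀nn hδ.le).trans (Int.le_ceil _)
  set X : ℝ := r₀ + 1 + δ * (N + 4) with hX
  have hX0 : 0 < X := by rw [hX]; nlinarith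
  have hXr : r₀ < X := by rw [hX]; nlinarith
  have hfar : (X : ℂ) ∈ (closure R.carrier)ᶜ := by
    intro hmem
    have : (X : ℂ) ∈ closedBall (0 : ℂ) r₀ := closure_minimal hr₀ isClosed_closedBall hmem
    have h1 : ‖(X : ℂ)‖ ≤ r₀ := by simpa using this
    rw [Complex.norm_real, Real.norm_eq_abs, abs_of_pos hX0] at h1
    linarith
  have hpath : JoinedIn (closure R.carrier)ᶜ e' (X : ℂ) :=
    ((R.isOpen_exterior.isConnected_iff_isPathConnected).1 R.isConnected_exterior).joinedIn
      e' he' _ hfar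
  have hγc : ContinuousOn (fun t : ℝ => hpath.somePath.extend t) (Icc 0 1) :=
    hpath.somePath.continuous_extend.continuousOn
  have hγE : ∀ t ∈ Icc (0 : ℝ) 1, hpath.somePath.extend t ∈ (closure R.carrier)ᶜ := fun t ht => by
    rw [Path.extend_extends' hpath.somePath ⟨t, ht⟩]
    exact hpath.somePath_mem _
  obtain ⟨l, hchain, hmeet, hlast⟩ := exists_kingChain_of_path hδ hγc
  simp only [Path.extend_zero, Path.extend_one] at hchain hmeet hlast
  -- none of the squares of the chain `Q₁ :: Q' :: l` is visited
  have hnot : ∀ q ∈ (x ⊓ y) :: floorSq δ e' :: l,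
      q ∉ (Λ.map (Hom.ofLE (faceGraph_le_zdGraph R.carrier δ))).support := by
    intro q hq hqs
    have hqI := hsupp q hqs
    rw [List.mem_cons] at hq
    rcases hq with rfl | hq
    · exact hQ₁ hqI
    · obtain ⟨t, ht, hγt⟩ := hmeet q hq
      exact not_isInnerFace_of_mem_closedSq R hδ hγt (hγE t ht) hqI
  have hchain' : List.IsChain (fun q q' => ∃ c, c ∈ corners q ∧ c ∈ corners q')
      ((x ⊓ y) :: floorSq δ e' :: l) :=
    List.isChain_cons_cons.2 ⟨hQ', hchain⟩
  -- transport the winding number along the chain and conclude outside the bounding box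
  have hW := walkWinding_eq_of_cornerChain (Λ.map (Hom.ofLE (faceGraph_le_zdGraph R.carrier δ)))
    (floorSq δ e' :: l) (x ⊓ y) hnot hchain' x (mem_corners_inf x hxy)
    (((x ⊓ y) :: floorSq δ e' :: l).getLast (by simp)) (by rw [corners]; simp)
  rw [hW]
  have hqN' : ((x ⊓ y) :: floorSq δ e' :: l).getLast (by simp) = (floorSq δ e' :: l).getLast (by simp) := by
    simp [List.getLast_cons]
  have hXq : (X : ℂ) ∈ closedSq δ (((x ⊓ y) :: floorSq δ e' :: l).getLast (by simp)) := by
    rw [hqN']; exact hlast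
  refine walkWinding_eq_zero_of_not_mem_sqBox (p₀ := 0) (n := N) (fun z hz => ?_) ?_
  · exact mem_sqBox_of_isInnerFace hr₀ hδ (hsupp z hz)
  · obtain ⟨-, hq0, -, -⟩ := hXq
    simp only [Complex.ofReal_re] at hq0
    rw [mem_sqBox, not_and_or]
    left
    simp only [Pi.sub_apply, Pi.one_apply, Pi.zero_apply, sub_zero, not_le]
    have h1 : δ * (N + 4) < δ * (((((x ⊓ y) :: floorSq δ e' :: l).getLast (by simp)) 0 : ℝ) + 1) := by
      rw [hX] at hq0; linarith
    have h2 : (N : ℝ) + 4 < (((x ⊓ y) :: floorSq δ e' :: l).getLast (by simp)) 0 + 1 :=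
      lt_of_mul_lt_mul_left h1 hδ.le
    have h3 : N + 4 < (((x ⊓ y) :: floorSq δ e' :: l).getLast (by simp)) 0 + 1 := by exact_mod_cast h2
    rw [lt_abs]
    left
    omega

end KirchhoffSlope

end Summit.CriticalPhenomena.CardyFormulaZ2.Theorems
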